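import Mathlib

/-!
# Note (ym-ir-idea-5 g4, lens RP / transfer-matrix bounds) on the squaring constant of
`AspectBootstrap.defectSquaring` (line `aspect-bootstrap`, ym-ir-idea-6; `Cruxes/IR/Lines/aspect_bootstrap.lean`)

The kernel proof of `defectSquaring` establishes the δ-dependent inequality
`δ' ≤ 2 · (432 · δ · exp (432 δ))²` (its step `hmain`) and only then discards the δ-dependence by
`exp (432 δ)² ≤ exp 432` (valid for `δ < 1/2`), which produces the packaged constant `2·432²·e^{432} ≈ e^{447}`
and the «basin entry» threshold `ε₀ = 1/(16 C) ≈ 10⁻¹⁹⁴`.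

The elementary lemma below packages the SAME intermediate inequality with the global, β-free constant `2^20`
(case split at `864 δ = 1`; the large-defect branch is free because `δ' ≤ 1`).  Consequence for the lines
`doubling-bridge` / `floor-handshake`: the certified basin-entry threshold of the seam
`coldPressureAt_of_exit_recursion` becomes `ε₀ = 1/(16·2^20) = 2^{-24} ≈ 6·10⁻⁸` instead of `≈ 10⁻¹⁹⁴`
(nothing changes logically — H/E quantify over every ε₀ — but purity `δᶜ ≤ 6·10⁻⁸` is a thermal trace excess
`x_{⌊L/4⌋}(L) ≲ 3·10⁻⁸`, i.e. `m_eff(β,L)·⌊L/4⌋ ≳ 17 + log(multiplicity)`, which spectral synthesis can address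
on `L ≈ 24–40` lattices at `β_W ≤ 2.4`; the `10⁻¹⁹⁴` threshold was not instrumentable at any volume).

HONEST FRAMING: bookkeeping of a constant; proves nothing about Yang–Mills, `BalabanLadder.IR` or the Clay problem;
R4 closes only the conditional finite-𝕋⁴ rung `BalabanLadder.UV`.
-/

namespace Summit.QuantumFields.YangMills.Cruxes.IR.AspectBootstrapConstantNote

/-- Packaging of `hmain` of `AspectBootstrap.defectSquaring` with the constant `2^20`:
if `0 ≤ δ`, `δ' ≤ 1` and `δ' ≤ 2 (432 δ e^{432 δ})²`, then `δ' ≤ 2^20 δ²`. -/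
theorem sq_threshold_packaging {δ δ' : ℝ} (h0 : 0 ≤ δ) (h1 : δ' ≤ 1)
    (h : δ' ≤ 2 * (432 * δ * Real.exp (432 * δ)) ^ 2) : δ' ≤ 2 ^ 20 * δ ^ 2 := by
  by_cases hs : 864 * δ ≤ 1
  · -- small-defect branch: `exp (432 δ)² = exp (864 δ) ≤ e ≤ 2.8`
    have he : Real.exp (432 * δ) ^ 2 ≤ 2.8 := by
      rw [← Real.exp_nat_mul]
      push_cast
      have h2 : Real.exp (2 * (432 * δ)) ≤ Real.exp 1 := Real.exp_le_exp.2 (by linarith)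
      have h3 : Real.exp 1 < 2.7182818286 := Real.exp_one_lt_d9
      linarith
    have hsq : 0 ≤ δ ^ 2 := sq_nonneg δ
    have e1 : 2 * (432 * δ * Real.exp (432 * δ)) ^ 2 = 2 * 432 ^ 2 * δ ^ 2 * Real.exp (432 * δ) ^ 2 := by
      ring
    rw [e1] at h
    have e2 : 2 * 432 ^ 2 * δ ^ 2 * Real.exp (432 * δ) ^ 2 ≤ 2 * 432 ^ 2 * δ ^ 2 * 2.8 :=
      mul_le_mul_of_nonneg_left he (by positivity)
    nlinarith
  · -- large-defect branch: `δ' ≤ 1 < (864 δ)² ≤ 2^20 δ²`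
    push_neg at hs
    have h864 : 1 < (864 * δ) ^ 2 := by nlinarith
    nlinarith

/-- The induced certified basin-entry threshold: with squaring constant `C = 2^20` the seam's tolerance
`1/(16 C)` is `2^{-24}` (`= 1/16777216 ≈ 5.96·10⁻⁸`). -/
theorem basin_threshold : (1 : ℝ) / (16 * 2 ^ 20) = 1 / 2 ^ 24 := by norm_num

end Summit.QuantumFields.YangMills.Cruxes.IR.AspectBootstrapConstantNote
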